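import Mathlib
import HarnessLib
import Literature.Probability.MarkovChains.SpectralProfile
import Literature.Probability.MarkovChains.SpectralProfileHeatKernelBound
import Literature.Probability.MarkovChains.SpectralProfileDiscreteTime
import Literature.Probability.MarkovChains.LInftyViaHalfTimeLTwo
import Literature.Probability.MarkovChains.CommuteTimeSymmetrization

/-!
# `L^∞` mixing from the spectral profile: Theorem 1.1 (`|h_t(x,y) − 1| ≤ ε` once `∫_{4π_*}^{4/ε} dv/(vΛ(v)) ≤ t/2`) and Corollary 2.1 (lazy chains, `sup|k(x,y,2n) − 1| ≤ ε` once `∫ dv/(αvΛ(v)) ≤ n`) of Goel–Montenegro–Tetali 2006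

HONEST FRAMING: exact (Metropolis-corrected) sampling algorithms for lattice gauge theory; figures
of merit are autocorrelation/cost numbers at stated couplings and volumes; no continuum-physics claim.

Source (READ on the hub's materialised text): S. Goel, R. Montenegro, P. Tetali, *Mixing time bounds
via the spectral profile*, Electron. J. Probab. **11** (2006) 1–26 = math.PR/0505690
[GoelMontenegroTetali2006]: §1.2 **THEOREM 1.1** ("For an irreducible chain, for `ε > 0`, the `L^∞`
mixing time `τ_∞(ε)` for the chain with kernel `H_t` satisfies `τ_∞(ε) ≤ ∫_{4π_*}^{4/ε}
2dv/(vΛ(v))`") with its proof in §2.1 ("Since we can apply Theorem 2.1 to either `H_t` or `H_t*`, we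
have `sup_{x,y}|h(x,y,t) − 1| ≤ 4/V(t/2)`"), and §2.3 **COROLLARY 2.1** ("Assume that `K(x,x) ≥ α > 0`
for all `x`. Then … `τ_∞(ε) ≤ 2⌈∫_{4π_*}^{4/ε} dv/(αvΛ(v))⌉`", proof: "`V_{KK*}(t/2) ≥ V(αt)`, and
similarly `V_{K*K}(t/2) ≥ V(αt)` … `|k(x,y,2n) − 1| ≤ d_{2,π}(K_n(x,·),π)·d_{2,π}(K*_n(y,·),π) ≤
4/V(αn)`").  THEOREM 2.1 is `SpectralProfileHeatKernelBound.lean`, its discrete twin THEOREM 2.2 and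
the `L²` half of COROLLARY 2.1 are `SpectralProfileDiscreteTime.lean`, the display (L∞) is
`LInftyViaHalfTimeLTwo.lean`; the adjoint chain `K*` (`timeReversal`) has the Dirichlet form,
diagonal, stationary law and `π_*` of `K`, so the functional Faber–Krahn hypothesis (FK) for `K`
serves both factors.  Everything below is PROVED (0 named facts).

As in the imported files the profile `Λ : ℝ → ℝ` is a PARAMETER with (FK) `𝓔(u,u) ≥
½Λ(4(Eu)²/Var u)·Var u` (`u ≥ 0` non-constant), (M) non-increasing and (P) `Λ ≥ m > 0` on a ray
`[a,∞)`, `0 < a ≤ 4π_*`; the printed instance `Λ = spectralProfile π P`, `a = 4π_*`, `m = λ₁` is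
`GoelMontenegroTetali2006_thm_1_1_spectralProfile` below ((FK) = LEMMA 2.1 of `SpectralProfile.lean`,
(M) = `spectralProfile_antitone`, (P) = `spectralGapR_le_spectralProfile` with `λ₁ > 0` the
irreducibility hypothesis).  The integer `⌈·⌉` of COROLLARY 2.1 is left to the reader of the
hypothesis `∫ ≤ αn`.

## Content
* `GoelMontenegroTetali2006_thm_2_1_timeReversal` (THEOREM 2.1 for `H_t*` from (FK) for `K`);
* **THEOREM 1.1** `GoelMontenegroTetali2006_thm_1_1` (`∫_a^{4/ε} dv/(vΛ(v)) ≤ t/2 ⇒ |h_t(x,y) − 1| ≤ ε`)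
  and its printed instance `GoelMontenegroTetali2006_thm_1_1_spectralProfile` (`Λ = spectralProfile`,
  `a = 4π_*`);
* `GoelMontenegroTetali2006_cor_2_1_lTwo_timeReversal` (the `K*K` twin of the `L²` half) and
  **COROLLARY 2.1** `GoelMontenegroTetali2006_cor_2_1` (`∫_a^{4/ε} dv/(vΛ(v)) ≤ αn ⇒ d⁽∞⁾(2n) ≤ ε`).
-/

namespace Literature.Probability.MarkovChains

open Finset Matrix Set MeasureTheory intervalIntegral

variable {X : Type*} [Fintype X] [DecidableEq X] {P : Matrix X X ℝ} {π : X → ℝ} {Λ : ℝ → ℝ}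
  {a m : ℝ}

/-! ## THEOREM 1.1 (continuous time) -/

section TheoremOneOne

/-- **THEOREM 2.1 for the adjoint chain** ("we can apply Theorem 2.1 to either `H_t` or `H_t*`"):
under (FK) for `K` (hence for `K*`, `𝓔_{K*} = 𝓔_K`), `Var_π(H*_t(y,·)/π) ≤ ε` once
`∫_a^{4/ε} dv/(vΛ(v)) ≤ t`. [cite: GoelMontenegroTetali2006, §2.1 proof of Theorem 1.1] -/
theorem GoelMontenegroTetali2006_thm_2_1_timeReversal (hπ : ∀ y, 0 < π y) (hπ1 : ∑ y, π y = 1)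
    (hP : IsRowStochastic P) (hst : IsStationary π P) (ha : 0 < a) (hm : 0 < m)
    (hΛm : ∀ v, a ≤ v → m ≤ Λ v) (hΛanti : AntitoneOn Λ (Ici a))
    (hFK : ∀ u : X → ℝ, (∀ y, 0 ≤ u y) → 0 < lawVariance π u →
      (1 / 2) * Λ (4 * lawMean π u ^ 2 / lawVariance π u) * lawVariance π u ≤ dirichletForm π P u)
    {y : X} (hay : a ≤ 4 * π y) {t ε : ℝ} (ht : 0 ≤ t) (hε : 0 < ε)
    (hint : ∫ v in a..(4 / ε), (v * Λ v)⁻¹ ≤ t) :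
    lawVariance π (heatKernelDensity (timeReversal π P) π t y) ≤ ε :=
  GoelMontenegroTetali2006_thm_2_1 hπ hπ1 (timeReversal_isRowStochastic hπ hP hst)
    (LevinPeres2017_prop_1_23_stationary (fun z => (hπ z).ne') hP.2) ha hm hΛm hΛanti
    (fun u hu hV => (dirichletForm_timeReversal hπ u).symm ▸ hFK u hu hV) hay ht hε hint

/-- **THEOREM 1.1 (Goel–Montenegro–Tetali 2006).**  `K` row-stochastic with stationary positive
probability vector `π`; `Λ` with (FK) for `K`, (M), (P) on `[a,∞)`, `0 < a ≤ 4π_*`.  Then for `ε > 0`,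
`t ≥ 0` with **`∫_a^{4/ε} dv/(vΛ(v)) ≤ t/2`**: **`|h_t(x,y) − 1| ≤ ε` for all `x, y`**, i.e.
`τ_∞(ε) ≤ ∫_{4π_*}^{4/ε} 2dv/(vΛ(v))` (`|h_t(x,y) − 1| ≤ d_{2,π}(H_{t/2}(x,·),π)·d_{2,π}(H*_{t/2}(y,·),π)
≤ √ε·√ε`). [cite: GoelMontenegroTetali2006, §1.2 Theorem 1.1; §2.1 proof of Theorem 1.1] -/
theorem GoelMontenegroTetali2006_thm_1_1 (hπ : ∀ y, 0 < π y) (hπ1 : ∑ y, π y = 1)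
    (hP : IsRowStochastic P) (hst : IsStationary π P) (ha : 0 < a) (hm : 0 < m)
    (hΛm : ∀ v, a ≤ v → m ≤ Λ v) (hΛanti : AntitoneOn Λ (Ici a))
    (hFK : ∀ u : X → ℝ, (∀ y, 0 ≤ u y) → 0 < lawVariance π u →
      (1 / 2) * Λ (4 * lawMean π u ^ 2 / lawVariance π u) * lawVariance π u ≤ dirichletForm π P u)
    (hax : ∀ x, a ≤ 4 * π x) {t ε : ℝ} (ht : 0 ≤ t) (hε : 0 < ε)
    (hint : ∫ v in a..(4 / ε), (v * Λ v)⁻¹ ≤ t / 2) (x y : X) :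
    |heatKernel P 1 t x y / π y - 1| ≤ ε := by
  have ht2 : 0 ≤ t / 2 := by linarith
  have hvar : ∀ (Q : Matrix X X ℝ), IsRowStochastic Q → ∀ z : X,
      piInner π (fun w => heatKernel Q 1 (t / 2) z w / π w - 1)
        (fun w => heatKernel Q 1 (t / 2) z w / π w - 1) = lawVariance π (heatKernelDensity Q π (t / 2) z) := by
    intro Q hQ z
    have h := piInner_sub_const_eq hπ1 (heatKernelDensity Q π (t / 2) z) 1
    rw [lawMean_heatKernelDensity hQ hπ, sub_self, zero_pow two_ne_zero, add_zero] at h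
    exact h
  have h1 : lawVariance π (heatKernelDensity P π (t / 2) x) ≤ ε :=
    GoelMontenegroTetali2006_thm_2_1 hπ hπ1 hP hst ha hm hΛm hΛanti hFK (hax x) ht2 hε hint
  have h2 : lawVariance π (heatKernelDensity (timeReversal π P) π (t / 2) y) ≤ ε :=
    GoelMontenegroTetali2006_thm_2_1_timeReversal hπ hπ1 hP hst ha hm hΛm hΛanti hFK (hax y) ht2 hε
      hint
  have h := GoelMontenegroTetali2006_abs_heatKernel_div_sub_one_le hP hst hπ hπ1 1 (t / 2) (t / 2) x y
  rw [add_halves, hvar P hP x,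
    hvar (timeReversal π P) (timeReversal_isRowStochastic hπ hP hst) y] at h
  refine h.trans ?_
  calc Real.sqrt (lawVariance π (heatKernelDensity P π (t / 2) x)) *
        Real.sqrt (lawVariance π (heatKernelDensity (timeReversal π P) π (t / 2) y))
      ≤ Real.sqrt ε * Real.sqrt ε :=
        mul_le_mul (Real.sqrt_le_sqrt h1) (Real.sqrt_le_sqrt h2) (Real.sqrt_nonneg _)
          (Real.sqrt_nonneg _)
    _ = ε := Real.mul_self_sqrt hε.le


/-- **THEOREM 1.1 as printed: `Λ = spectralProfile`, `a = 4π_*`.**  For an irreducible chain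
(`λ₁ = spectralGapR π P > 0`; `π_* = π(x₀)` the least mass), `ε > 0`, `t ≥ 0` with
`∫_{4π_*}^{4/ε} dv/(vΛ(v)) ≤ t/2`: `|h_t(x,y) − 1| ≤ ε` for all `x, y`.
[cite: GoelMontenegroTetali2006, §1.2 Theorem 1.1] -/
theorem GoelMontenegroTetali2006_thm_1_1_spectralProfile [Nontrivial X] (hπ : ∀ y, 0 < π y)
    (hπ1 : ∑ y, π y = 1) (hP : IsRowStochastic P) (hst : IsStationary π P)
    (hgap : 0 < spectralGapR π P) {x₀ : X} (hmin : ∀ x, π x₀ ≤ π x) {t ε : ℝ} (ht : 0 ≤ t)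
    (hε : 0 < ε) (hint : ∫ v in (4 * π x₀)..(4 / ε), (v * spectralProfile π P v)⁻¹ ≤ t / 2)
    (x y : X) : |heatKernel P 1 t x y / π y - 1| ≤ ε := by
  have hπ0 : ∀ z, 0 ≤ π z := fun z => (hπ z).le
  have ha : 0 < 4 * π x₀ := by linarith [hπ x₀]
  -- every `v ≥ 4π_*` dominates `π({x₀})`
  have hS : ∀ v, 4 * π x₀ ≤ v → ∃ S : Finset X, S.Nonempty ∧ ∑ z ∈ S, π z ≤ v := fun v hv =>
    ⟨{x₀}, singleton_nonempty x₀, by rw [sum_singleton]; linarith [hπ x₀]⟩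
  exact GoelMontenegroTetali2006_thm_1_1 hπ hπ1 hP hst ha hgap
    (fun v hv => spectralGapR_le_spectralProfile hπ hπ1 hP.1 (hS v hv))
    (fun v hv w _ hvw => spectralProfile_antitone hπ0 hP.1 (hS v hv) hvw)
    (fun u hu hV => GoelMontenegroTetali2006_lemma_2_1 hπ hπ1 hP.1 hu hV)
    (fun z => by linarith [hmin z]) ht hε hint x y

end TheoremOneOne

/-! ## COROLLARY 2.1 (lazy discrete-time chains) -/

section CorollaryTwoOne

/-- **"Similarly `V_{K*K}(t/2) ≥ V(αt)`"**: the `L²` half of Corollary 2.1 for the adjoint chain —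
`𝓔_{K*} = 𝓔_K`, `K*(x,x) = K(x,x)`, `πK* = π` — so `∫_a^{4/ε} dv/(vΛ(v)) ≤ αn` gives
`sup_x d_{2,π}(K*_n(x,·),π) ≤ √ε`. [cite: GoelMontenegroTetali2006, §2.3 proof of Corollary 2.1] -/
theorem GoelMontenegroTetali2006_cor_2_1_lTwo_timeReversal (hπ : ∀ y, 0 < π y)
    (hπ1 : ∑ y, π y = 1) (hP : IsRowStochastic P) (hst : IsStationary π P) (ha : 0 < a)
    (hm : 0 < m) (hΛm : ∀ v, a ≤ v → m ≤ Λ v) (hΛanti : AntitoneOn Λ (Ici a))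
    (hFK : ∀ u : X → ℝ, (∀ y, 0 ≤ u y) → 0 < lawVariance π u →
      (1 / 2) * Λ (4 * lawMean π u ^ 2 / lawVariance π u) * lawVariance π u ≤ dirichletForm π P u)
    {α : ℝ} (hα0 : 0 < α) (hα : ∀ x, α ≤ P x x) (hax : ∀ x, a ≤ 4 * π x) {n : ℕ} {ε : ℝ}
    (hε : 0 < ε) (hint : ∫ v in a..(4 / ε), (v * Λ v)⁻¹ ≤ α * n) :
    lTwoDist (timeReversal π P) π n ≤ Real.sqrt ε :=
  GoelMontenegroTetali2006_cor_2_1_lTwo hπ hπ1 (timeReversal_isRowStochastic hπ hP hst)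
    (LevinPeres2017_prop_1_23_stationary (fun y => (hπ y).ne') hP.2) ha hm hΛm hΛanti
    (fun u hu hV => (dirichletForm_timeReversal hπ u).symm ▸ hFK u hu hV) hα0
    (fun x => by rw [timeReversal_apply, mul_div_right_comm, div_self (hπ x).ne', one_mul]; exact hα x)
    hax hε hint

/-- **COROLLARY 2.1 (Goel–Montenegro–Tetali 2006).**  `K` row-stochastic with stationary positive
probability vector `π`, lazy (`K(x,x) ≥ α > 0`); `Λ` with (FK) for `K`, (M), (P) on `[a,∞)`,
`0 < a ≤ 4π_*`.  Then for `ε > 0` and every `n` with **`∫_a^{4/ε} dv/(vΛ(v)) ≤ αn`**: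
**`sup_{x,y} |k(x,y,2n) − 1| ≤ ε`**, i.e. `τ_∞(ε) ≤ 2n` ("`τ_∞(ε) ≤ 2⌈∫_{4π_*}^{4/ε} dv/(αvΛ(v))⌉`").
[cite: GoelMontenegroTetali2006, §2.3 Corollary 2.1 (statement and proof)] -/
theorem GoelMontenegroTetali2006_cor_2_1 (hπ : ∀ y, 0 < π y) (hπ1 : ∑ y, π y = 1)
    (hP : IsRowStochastic P) (hst : IsStationary π P) (ha : 0 < a) (hm : 0 < m)
    (hΛm : ∀ v, a ≤ v → m ≤ Λ v) (hΛanti : AntitoneOn Λ (Ici a))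
    (hFK : ∀ u : X → ℝ, (∀ y, 0 ≤ u y) → 0 < lawVariance π u →
      (1 / 2) * Λ (4 * lawMean π u ^ 2 / lawVariance π u) * lawVariance π u ≤ dirichletForm π P u)
    {α : ℝ} (hα0 : 0 < α) (hα : ∀ x, α ≤ P x x) (hax : ∀ x, a ≤ 4 * π x) {n : ℕ} {ε : ℝ}
    (hε : 0 < ε) (hint : ∫ v in a..(4 / ε), (v * Λ v)⁻¹ ≤ α * n) : lInfDist P π (2 * n) ≤ ε := by
  have h1 := GoelMontenegroTetali2006_cor_2_1_lTwo hπ hπ1 hP hst ha hm hΛm hΛanti hFK hα0 hα hax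
    hε hint
  have h2 := GoelMontenegroTetali2006_cor_2_1_lTwo_timeReversal hπ hπ1 hP hst ha hm hΛm hΛanti
    hFK hα0 hα hax hε hint
  refine (GoelMontenegroTetali2006_lInfDist_two_mul_le hP hst hπ hπ1 n).trans ?_
  calc lTwoDist P π n * lTwoDist (timeReversal π P) π n ≤ Real.sqrt ε * Real.sqrt ε :=
        mul_le_mul h1 h2 (lTwoDist_nonneg _ _ _) (Real.sqrt_nonneg _)
    _ = ε := Real.mul_self_sqrt hε.le


end CorollaryTwoOne

end Literature.Probability.MarkovChains
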